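import Summits.CriticalPhenomena.Ising3DConformalLimit.Theorems.PlantedPinningGaussianPinningSaturationDefs
import Summits.CriticalPhenomena.Ising3DConformalLimit.Theorems.PlantedPinningPinningEfficiencyLeOnePinningLemma

/-!
# The pinning-lemma ceiling `e^{lin}_L(k) ≤ 1` for the LINEAR efficiency
(stub `stub_linEffLeOne` of line `birth`, crux `GaussianPinningSaturation`,
item stmt-CriticalPhenomena-8452; objects in `…GaussianPinningSaturationDefs`)

Informal statement. For the critical `+`-boundary Ising box `Λ_L = box 3 L` on `ℤ³`
(`β = β_c(3)`, `h = 0`), `n = |Λ_L|` and `k ≤ n`, the LINEAR pinning efficiency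
`e^{lin}_L(k) = k·v_k/((n+1)(n−k+1))`, `v_k = (n choose k)⁻¹ Σ_{|P| = k} R_L(P)`, of the
Schur-complement residual `R_L(P) = linResidual L P = Var⁺(M_L) − cᵀ (G_{PP})⁻¹ c`
(`c_a = Cov⁺(M_L, σ_a)`, `G_{PP}` the covariance matrix of the pinned spins, `⁻¹` Mathlib's
`Matrix.inv`) satisfies `e^{lin}_L(k) ≤ 1` (`stub_linEffLeOne`, registered signature verbatim).
`R_L(P)` is the conditional variance given the pins of the Gaussian vector with the Ising
covariance, so this is the pinning lemma (Montanari 2008, arXiv:0709.0145; Raghavendra–Tan,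
SODA 2012, Lemma 4.3; El Alaoui–Montanari 2021, eqs. (1.4)–(1.6)) for that vector.

Proof (finite sums; abstract part for centred observables `t_x`, positive weights `w`,
`G(x,y) = Σ w t_x t_y`). (1) `G_{PP}` is nonsingular for `P ⊆ Λ`: its quadratic form is
`Σ w (Σ_a v_a t_a)²`, and a single-site modification of a pattern changes `Σ_a v_a t_a` unless
`v = 0` (`isUnit_det_covP`). (2) Least squares (folklore): the residual `R_P = M − β*·t_P`,
`β* = G_{PP}⁻¹ c_P`, satisfies the normal equations and `Σ w R_P M = Σ w R_P² = R_L(P)`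
(`residual`), whence `0 ≤ R_L(Q) ≤ Σ w (M − γ·t_Q)²` (`residual_le`). (3) One step
(Raghavendra–Tan 2012, Lemma 4.3): testing `R_L(P ∪ {z})` with `R_P − κ_z t_z`,
`κ_z = Σ w R_P t_z`, `G(z,z) ≤ 1`, gives `κ_z² ≤ R_L(P) − R_L(P ∪ {z})`; `Σ_{z ∉ P} κ_z = R_L(P)`
and Cauchy–Schwarz over `z` (`one_step_lin`). (4) Averaging over `j`-subsets and the Riccati
inequality verbatim as in `PlantedPinningCeiling.pinning_lemma` (`pin_bound`). (5) Ising case: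
plus expectations are `w`-sums (`integral_isingMeasure`), `t_x = σ_x − ⟨σ_x⟩⁺`, `G = cov L`,
`G(z,z) = 1 − ⟨σ_z⟩² ≤ 1`; one spin flip of the all-plus pattern realises (1). References:
Montanari 2008 (arXiv:0709.0145); Raghavendra–Tan 2012, Lemma 4.3; El Alaoui–Montanari 2021,
eqs. (1.4)–(1.6); normal equations of least squares (folklore).
-/

noncomputable section

namespace Summit.CriticalPhenomena.Ising3DConformalLimit.PlantedPinningGaussianPinningSaturation

open scoped BigOperators Classical
open Finset MeasureTheory Matrix
open Literature.Probability.LatticeModels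
open Summit.CriticalPhenomena.Ising3DConformalLimit.Theses.PlantedPinning
open Summit.CriticalPhenomena.Ising3DConformalLimit.PlantedPinningCeiling

/-! ### Least squares and the pinning lemma for a finite weighted family of centred observables -/

section Abstract

variable {V Ω : Type*} [DecidableEq V] [Fintype Ω]

/-- Pure algebra: a weighted moment against a linear combination of observables is the
corresponding combination of moments. [folklore] -/
private theorem wsum_mul_lin {ι : Type*} (w g : Ω → ℝ) (Q : Finset ι) (γ : ι → ℝ)
    (u : ι → Ω → ℝ) :
    ∑ ω, w ω * g ω * (∑ x ∈ Q, γ x * u x ω) = ∑ x ∈ Q, γ x * ∑ ω, w ω * g ω * u x ω := by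
  simp only [Finset.mul_sum]
  rw [Finset.sum_comm]
  exact Finset.sum_congr rfl fun x _ => Finset.sum_congr rfl fun ω _ => by ring

/-- Pure algebra: a weighted moment against a sum of observables. [folklore] -/
private theorem wsum_mul_sum {ι : Type*} (w g : Ω → ℝ) (Q : Finset ι) (u : ι → Ω → ℝ) :
    ∑ ω, w ω * g ω * (∑ x ∈ Q, u x ω) = ∑ x ∈ Q, ∑ ω, w ω * g ω * u x ω := by
  simp only [Finset.mul_sum]
  exact Finset.sum_comm

variable {w : Ω → ℝ} {t : V → Ω → ℝ} {G : V → V → ℝ} {Λ : Finset V} {c : V → ℝ}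
  {Mc : Ω → ℝ} {Rs : Finset V → ℝ}
  (hw : ∀ ω, 0 < w ω) (hG : ∀ x y, G x y = ∑ ω, w ω * t x ω * t y ω)
  (hflip : ∀ x ∈ Λ, ∃ ω ω', t x ω ≠ t x ω' ∧ ∀ y, y ≠ x → t y ω = t y ω')
  (hc : ∀ y, c y = ∑ x ∈ Λ, G x y) (hMc : ∀ ω, Mc ω = ∑ x ∈ Λ, t x ω)
  (hRs : ∀ P : Finset V, Rs P = (∑ x ∈ Λ, ∑ y ∈ Λ, G x y) -
      ∑ a : ↥P, ∑ b : ↥P, c a * (Matrix.of fun a b : ↥P => G a b)⁻¹ a b * c b)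
  (hG1 : ∀ z, G z z ≤ 1)

include hw hG hflip in
/-- The Gram (covariance) matrix `(G(a,b))_{a,b ∈ P}` is nonsingular for `P ⊆ Λ`: its quadratic
form is `Σ w (Σ_a v_a t_a)²`, which vanishes only if `Σ_a v_a t_a ≡ 0` (all `w > 0`), and a
single-site modification of a pattern rules this out unless `v = 0`. [folklore] -/
private theorem isUnit_det_covP {P : Finset V} (hP : P ⊆ Λ) :
    IsUnit (Matrix.of fun a b : ↥P => G a b).det := by
  set GP : Matrix ↥P ↥P ℝ := Matrix.of fun a b : ↥P => G a b with hGP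
  rw [← Matrix.isUnit_iff_isUnit_det, ← Matrix.mulVec_injective_iff_isUnit]
  intro v v' hvv'
  rw [← sub_eq_zero]
  set u : ↥P → ℝ := v - v' with hu
  have hu0 : GP *ᵥ u = 0 := by rw [hu, Matrix.mulVec_sub, hvv', sub_self]
  set f : Ω → ℝ := fun ω => ∑ a : ↥P, u a * t a ω with hf
  -- the quadratic form of `GP` at `u` is the second moment of `f`, hence `f ≡ 0`
  have hrow : ∀ b : ↥P, ∑ ω, w ω * f ω * t b ω = (GP *ᵥ u) b := fun b => by
    calc ∑ ω, w ω * f ω * t b ω = ∑ ω, w ω * t b ω * ∑ a : ↥P, u a * t a ω :=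
          Finset.sum_congr rfl fun ω _ => by simp only [hf]; ring
      _ = ∑ a : ↥P, u a * ∑ ω, w ω * t b ω * t a ω :=
          wsum_mul_lin w (t b) Finset.univ u fun a : ↥P => t a
      _ = (GP *ᵥ u) b := by
          rw [Matrix.mulVec_apply_eq_sum]
          exact Finset.sum_congr rfl fun a _ => by rw [hGP, Matrix.of_apply, hG]; ring
  have hz : ∑ ω, w ω * f ω ^ 2 = 0 := by
    calc ∑ ω, w ω * f ω ^ 2 = ∑ ω, w ω * f ω * ∑ b : ↥P, u b * t b ω :=
          Finset.sum_congr rfl fun ω _ => by simp only [hf]; ring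
      _ = ∑ b : ↥P, u b * ∑ ω, w ω * f ω * t b ω :=
          wsum_mul_lin w f Finset.univ u fun b : ↥P => t b
      _ = 0 := by simp [hrow, hu0]
  have hf0 : ∀ ω, f ω = 0 := fun ω => by
    have h := (Finset.sum_eq_zero_iff_of_nonneg fun ω _ =>
      mul_nonneg (hw ω).le (sq_nonneg (f ω))).1 hz ω (Finset.mem_univ ω)
    exact (pow_eq_zero_iff two_ne_zero).1 ((mul_eq_zero.1 h).resolve_left (hw ω).ne')
  refine funext fun a => Classical.byContradiction fun hua => ?_
  obtain ⟨ω, ω', hx, hy⟩ := hflip a (hP a.2)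
  have hdiff : f ω - f ω' = u a * (t a ω - t a ω') := by
    simp only [hf]
    rw [← Finset.sum_sub_distrib, Finset.sum_eq_single a]
    · ring
    · exact fun b _ hb => by rw [hy b (fun h => hb (Subtype.ext h)), sub_self]
    · exact fun h => absurd (Finset.mem_univ a) h
  rw [hf0 ω, hf0 ω', sub_self] at hdiff
  exact mul_ne_zero hua (sub_ne_zero.2 hx) hdiff.symm

include hw hG hflip hc hMc hRs in
/-- **Least squares** for `M = Σ_{x ∈ Λ} t_x` on the observables `t_P`, `P ⊆ Λ`: the residual
`R = M − β*·t_P` with `β* = G_{PP}⁻¹ c_P` satisfies the normal equations `Σ w R t_y = 0`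
(`y ∈ P`) and `Σ w R M = Σ w R² = Rs P = Var M − cᵀ G_{PP}⁻¹ c`. [folklore] -/
private theorem residual {P : Finset V} (hP : P ⊆ Λ) :
    ∃ (β : V → ℝ) (R : Ω → ℝ), (∀ ω, R ω = Mc ω - ∑ x ∈ P, β x * t x ω) ∧
      (∀ y ∈ P, ∑ ω, w ω * R ω * t y ω = 0) ∧
      ∑ ω, w ω * R ω * Mc ω = Rs P ∧ ∑ ω, w ω * R ω ^ 2 = Rs P := by
  set β' : ↥P → ℝ := (Matrix.of fun a b : ↥P => G a b)⁻¹ *ᵥ fun a => c a with hβ'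
  -- normal equations in matrix form: `G_{PP} β* = c_P`
  have hne : ∀ y (hy : y ∈ P), ∑ a : ↥P, G y a * β' a = c y := fun y hy => by
    have h : ((Matrix.of fun a b : ↥P => G a b) *ᵥ β') ⟨y, hy⟩ = c y := by
      rw [hβ', Matrix.mulVec_mulVec, Matrix.mul_nonsing_inv _ (isUnit_det_covP hw hG hflip hP),
        Matrix.one_mulVec]
    simpa only [Matrix.mulVec_apply_eq_sum, Matrix.of_apply] using h
  set βV : V → ℝ := fun x => if hx : x ∈ P then β' ⟨x, hx⟩ else 0 with hβV
  set R : Ω → ℝ := fun ω => Mc ω - ∑ x ∈ P, βV x * t x ω with hR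
  -- moments of `M`, of `β*·t_P` and of `R` against an observable
  have hMt : ∀ y, ∑ ω, w ω * Mc ω * t y ω = c y := fun y => by
    calc ∑ ω, w ω * Mc ω * t y ω = ∑ ω, w ω * t y ω * ∑ x ∈ Λ, t x ω :=
          Finset.sum_congr rfl fun ω _ => by rw [hMc]; ring
      _ = c y := by
          rw [wsum_mul_sum, hc]
          refine Finset.sum_congr rfl fun x _ => ?_
          rw [hG]; exact Finset.sum_congr rfl fun ω _ => by ring
  have hℓg : ∀ g : Ω → ℝ, ∑ ω, w ω * g ω * (∑ x ∈ P, βV x * t x ω) =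
      ∑ a : ↥P, β' a * ∑ ω, w ω * g ω * t a ω := fun g => by
    have hℓ : ∀ ω, ∑ x ∈ P, βV x * t x ω = ∑ a : ↥P, β' a * t a ω := fun ω => by
      rw [← Finset.sum_coe_sort P (fun x => βV x * t x ω)]
      exact Finset.sum_congr rfl fun a _ => by simp [hβV]
    simp only [hℓ]
    exact wsum_mul_lin w g Finset.univ β' fun a : ↥P => t a
  have hsplit : ∀ g : Ω → ℝ, ∑ ω, w ω * R ω * g ω =
      ∑ ω, w ω * Mc ω * g ω - ∑ ω, w ω * g ω * (∑ x ∈ P, βV x * t x ω) := fun g => by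
    rw [← Finset.sum_sub_distrib]; exact Finset.sum_congr rfl fun ω _ => by rw [hR]; ring
  have h0 : ∀ y ∈ P, ∑ ω, w ω * R ω * t y ω = 0 := fun y hy => by
    rw [hsplit, hMt, hℓg, ← hne y hy, ← Finset.sum_sub_distrib]
    exact Finset.sum_eq_zero fun a _ => by rw [← hG]; ring
  have hMM : ∑ ω, w ω * Mc ω * Mc ω = ∑ x ∈ Λ, ∑ y ∈ Λ, G x y := by
    calc ∑ ω, w ω * Mc ω * Mc ω = ∑ ω, w ω * Mc ω * ∑ y ∈ Λ, t y ω :=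
          Finset.sum_congr rfl fun ω _ => by rw [← hMc]
      _ = ∑ y ∈ Λ, c y := by rw [wsum_mul_sum]; exact Finset.sum_congr rfl fun y _ => hMt y
      _ = ∑ x ∈ Λ, ∑ y ∈ Λ, G x y := by
          rw [Finset.sum_comm]; exact Finset.sum_congr rfl fun y _ => hc y
  have hM : ∑ ω, w ω * R ω * Mc ω = Rs P := by
    rw [hsplit, hℓg, hMM, hRs P]
    congr 1
    refine Finset.sum_congr rfl fun a _ => ?_
    rw [hMt, hβ', Matrix.mulVec_apply_eq_sum, Finset.sum_mul]
    exact Finset.sum_congr rfl fun b _ => by ring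
  have hRR : ∑ ω, w ω * R ω ^ 2 = Rs P := by
    calc ∑ ω, w ω * R ω ^ 2
          = ∑ ω, w ω * R ω * Mc ω - ∑ ω, w ω * R ω * ∑ x ∈ P, βV x * t x ω := by
          rw [← Finset.sum_sub_distrib]; exact Finset.sum_congr rfl fun ω _ => by rw [hR]; ring
      _ = Rs P := by
          rw [hM, wsum_mul_lin w R P βV t, Finset.sum_eq_zero fun x hx => ?_, sub_zero]
          rw [h0 x hx, mul_zero]
  exact ⟨βV, R, fun ω => rfl, h0, hM, hRR⟩

include hw hG hflip hc hMc hRs in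
/-- **Variational characterisation of the linear residual**: `0 ≤ Rs Q ≤ Σ w (M − γ·t_Q)²` for
every coefficient vector `γ`, `Q ⊆ Λ` (Pythagoras with the normal equations). [folklore] -/
private theorem residual_le {Q : Finset V} (hQ : Q ⊆ Λ) (γ : V → ℝ) :
    0 ≤ Rs Q ∧ Rs Q ≤ ∑ ω, w ω * (Mc ω - ∑ x ∈ Q, γ x * t x ω) ^ 2 := by
  obtain ⟨β, R, -, h0, hM, hR⟩ := residual hw hG hflip hc hMc hRs hQ
  set F : Ω → ℝ := fun ω => Mc ω - ∑ x ∈ Q, γ x * t x ω with hF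
  have hRF : ∑ ω, w ω * R ω * F ω = Rs Q := by
    calc ∑ ω, w ω * R ω * F ω
          = ∑ ω, w ω * R ω * Mc ω - ∑ ω, w ω * R ω * ∑ x ∈ Q, γ x * t x ω := by
          rw [← Finset.sum_sub_distrib]; exact Finset.sum_congr rfl fun ω _ => by rw [hF]; ring
      _ = Rs Q := by
          rw [hM, wsum_mul_lin w R Q γ t, Finset.sum_eq_zero fun x hx => ?_, sub_zero]
          rw [h0 x hx, mul_zero]
  have hpos : 0 ≤ ∑ ω, w ω * (F ω - R ω) ^ 2 :=
    Finset.sum_nonneg fun ω _ => mul_nonneg (hw ω).le (sq_nonneg _)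
  have hexp : ∑ ω, w ω * (F ω - R ω) ^ 2 =
      ∑ ω, w ω * F ω ^ 2 - 2 * ∑ ω, w ω * R ω * F ω + ∑ ω, w ω * R ω ^ 2 := by
    rw [Finset.mul_sum, ← Finset.sum_sub_distrib, ← Finset.sum_add_distrib]
    exact Finset.sum_congr rfl fun ω _ => by ring
  rw [hRF, hR] at hexp
  exact ⟨hR ▸ Finset.sum_nonneg fun ω _ => mul_nonneg (hw ω).le (sq_nonneg _), by linarith⟩

include hw hG hflip hc hMc hRs hG1 in
/-- **One step of the pinning lemma for the linear residual**: for `P ⊆ Λ` with `Λ ∖ P ≠ ∅`,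
`Rs(P)² / |Λ ∖ P| ≤ Σ_{z ∈ Λ ∖ P} (Rs P − Rs (P ∪ {z}))`: one more regressor `t_z` lowers the
residual by at least `κ_z² = (Σ w R_P t_z)²` since `Σ w t_z² = G(z,z) ≤ 1`, the `κ_z` sum to
`Rs P` over `z ∉ P`, and Cauchy–Schwarz over `z` (Raghavendra–Tan 2012, Lemma 4.3). [folklore] -/
private theorem one_step_lin {P : Finset V} (hP : P ⊆ Λ) (hne : (Λ \ P).Nonempty) :
    Rs P ^ 2 / #(Λ \ P) ≤ ∑ z ∈ Λ \ P, (Rs P - Rs (insert z P)) := by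
  obtain ⟨β, R, hRdef, h0, hM, hR⟩ := residual hw hG hflip hc hMc hRs hP
  obtain ⟨κ, hκ⟩ : ∃ κ : V → ℝ, ∀ z, κ z = ∑ ω, w ω * R ω * t z ω := ⟨_, fun _ => rfl⟩
  have hm : (0 : ℝ) < #(Λ \ P) := by exact_mod_cast hne.card_pos
  -- (1) one more regressor lowers the residual by at least `κ z ^ 2`
  have hdrop : ∀ z ∈ Λ \ P, κ z ^ 2 ≤ Rs P - Rs (insert z P) := by
    intro z hz
    obtain ⟨hzΛ, hzP⟩ := Finset.mem_sdiff.1 hz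
    have hF : ∀ ω, Mc ω - ∑ x ∈ insert z P, Function.update β z (κ z) x * t x ω =
        R ω - κ z * t z ω := fun ω => by
      have hP' : ∑ x ∈ P, Function.update β z (κ z) x * t x ω = ∑ x ∈ P, β x * t x ω :=
        Finset.sum_congr rfl fun x hx => by
          rw [Function.update_of_ne (ne_of_mem_of_not_mem hx hzP)]
      rw [Finset.sum_insert hzP, Function.update_self, hP', hRdef]
      ring
    have hvar := (residual_le hw hG hflip hc hMc hRs (Finset.insert_subset hzΛ hP)
      (Function.update β z (κ z))).2
    have hsum : ∑ ω, w ω * (Mc ω - ∑ x ∈ insert z P, Function.update β z (κ z) x * t x ω) ^ 2 =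
        ∑ ω, w ω * (R ω - κ z * t z ω) ^ 2 := Finset.sum_congr rfl fun ω _ => by rw [hF ω]
    have hexp : ∑ ω, w ω * (R ω - κ z * t z ω) ^ 2 = ∑ ω, w ω * R ω ^ 2
        - 2 * κ z * ∑ ω, w ω * R ω * t z ω + κ z ^ 2 * ∑ ω, w ω * t z ω * t z ω := by
      rw [Finset.mul_sum, Finset.mul_sum, ← Finset.sum_sub_distrib, ← Finset.sum_add_distrib]
      exact Finset.sum_congr rfl fun ω _ => by ring
    rw [hR, ← hG z z, ← hκ z] at hexp
    rw [hsum, hexp] at hvar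
    have hprod : κ z ^ 2 * G z z ≤ κ z ^ 2 := mul_le_of_le_one_right (sq_nonneg _) (hG1 z)
    nlinarith [hvar, hprod]
  -- (2) the covariances with the free observables sum to the residual
  have hsumκ : ∑ z ∈ Λ \ P, κ z = Rs P := by
    calc ∑ z ∈ Λ \ P, κ z = ∑ ω, w ω * R ω * (Mc ω - ∑ x ∈ P, t x ω) := by
          simp only [hκ]
          rw [← wsum_mul_sum w R (Λ \ P) t]
          exact Finset.sum_congr rfl fun ω _ => by rw [hMc ω, ← Finset.sum_sdiff hP]; ring
      _ = ∑ ω, w ω * R ω * Mc ω - ∑ ω, w ω * R ω * (∑ x ∈ P, t x ω) := by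
          rw [← Finset.sum_sub_distrib]; exact Finset.sum_congr rfl fun ω _ => by ring
      _ = Rs P := by
          rw [hM, wsum_mul_sum w R P t, Finset.sum_eq_zero fun x hx => h0 x hx, sub_zero]
  -- (3) Cauchy–Schwarz over the new pin
  calc Rs P ^ 2 / #(Λ \ P) = (∑ z ∈ Λ \ P, κ z) ^ 2 / #(Λ \ P) := by rw [hsumκ]
    _ ≤ ∑ z ∈ Λ \ P, κ z ^ 2 := by
        rw [div_le_iff₀ hm]
        have := sq_sum_le_card_mul_sum_sq (s := Λ \ P) (f := κ)
        linarith
    _ ≤ ∑ z ∈ Λ \ P, (Rs P - Rs (insert z P)) := Finset.sum_le_sum hdrop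

include hw hG hflip hc hMc hRs hG1 in
/-- **The pinning lemma for the linear residual** (Montanari 2008; Raghavendra–Tan 2012,
Lemma 4.3; El Alaoui–Montanari 2021, (1.4)–(1.6)): for `k ≤ n = |Λ|`,
`k · (Σ_{P ⊆ Λ, |P| = k} Rs P) / (n choose k) ≤ (n + 1) · (n − k + 1)` — averaging
`one_step_lin` over `j`-subsets and integrating the Riccati inequality, verbatim as in
`PlantedPinningCeiling.pinning_lemma`. [folklore] -/
private theorem pin_bound {k : ℕ} (hkn : k ≤ #Λ) :
    (k : ℝ) * ((∑ P ∈ Λ.powersetCard k, Rs P) / ((#Λ).choose k : ℝ)) ≤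
      ((#Λ : ℝ) + 1) * ((#Λ : ℝ) - k + 1) := by
  set n := #Λ with hn
  set v : ℕ → ℝ := fun j => (∑ P ∈ Λ.powersetCard j, Rs P) / (n.choose j : ℝ) with hv
  have h0 : ∀ j, 0 ≤ v j := fun j =>
    div_nonneg (Finset.sum_nonneg fun Q hQ => (residual_le hw hG hflip hc hMc hRs
      (Finset.mem_powersetCard.1 hQ).1 fun _ => 0).1) (Nat.cast_nonneg _)
  have hstepv : ∀ j, j < n → v (j + 1) ≤ v j - (v j) ^ 2 / ((n : ℝ) - j) ^ 2 := by
    intro j hj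
    set A := ∑ P ∈ Λ.powersetCard j, Rs P with hA
    set A' := ∑ Q ∈ Λ.powersetCard (j + 1), Rs Q
    set Cj : ℝ := (n.choose j : ℝ) with hCj
    set Cj' : ℝ := (n.choose (j + 1) : ℝ) with hCj'
    set m : ℝ := (n : ℝ) - j with hm
    have hCpos : 0 < Cj := by rw [hCj]; exact_mod_cast Nat.choose_pos hj.le
    have hC'pos : 0 < Cj' := by rw [hCj']; exact_mod_cast Nat.choose_pos hj
    have hmpos : 0 < m := by
      have : (j : ℝ) + 1 ≤ n := by exact_mod_cast hj
      rw [hm]; linarith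
    have hpascal : ((j : ℝ) + 1) * Cj' = m * Cj := by
      have h := Nat.choose_succ_right_eq n j
      have hcast : ((n - j : ℕ) : ℝ) = (n : ℝ) - j := Nat.cast_sub hj.le
      rw [hCj', hCj, hm, ← hcast]
      exact_mod_cast (by rw [mul_comm] at h; linarith [h] :
        (j + 1) * n.choose (j + 1) = (n - j) * n.choose j)
    have hcardT : ∀ P ∈ Λ.powersetCard j, (#(Λ \ P) : ℝ) = m := fun P hP => by
      obtain ⟨hPΛ, hPc⟩ := Finset.mem_powersetCard.1 hP
      rw [Finset.card_sdiff_of_subset hPΛ, hPc, Nat.cast_sub hj.le, hm]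
    have hsum1 : ∑ P ∈ Λ.powersetCard j, (Rs P) ^ 2 / m ≤
        ∑ P ∈ Λ.powersetCard j, ∑ z ∈ Λ \ P, (Rs P - Rs (insert z P)) := by
      refine Finset.sum_le_sum fun P hP => ?_
      obtain ⟨hPΛ, hPc⟩ := Finset.mem_powersetCard.1 hP
      have hne : (Λ \ P).Nonempty := by
        rw [← Finset.card_pos, Finset.card_sdiff_of_subset hPΛ, hPc]; omega
      have := one_step_lin hw hG hflip hc hMc hRs hG1 hPΛ hne
      rwa [hcardT P hP] at this
    have hrhs : ∑ P ∈ Λ.powersetCard j, ∑ z ∈ Λ \ P, (Rs P - Rs (insert z P)) =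
        m * A - ((j : ℝ) + 1) * A' := by
      have hin : ∀ P ∈ Λ.powersetCard j, ∑ z ∈ Λ \ P, (Rs P - Rs (insert z P)) =
          m * Rs P - ∑ z ∈ Λ \ P, Rs (insert z P) := fun P hP => by
        rw [Finset.sum_sub_distrib, Finset.sum_const, nsmul_eq_mul, hcardT P hP]
      rw [Finset.sum_congr rfl hin, Finset.sum_sub_distrib, ← Finset.mul_sum,
        sum_powersetCard_sum_sdiff_insert Λ j Rs]
    have hlhs : A ^ 2 / (Cj * m) ≤ ∑ P ∈ Λ.powersetCard j, (Rs P) ^ 2 / m := by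
      have hcs := sq_sum_le_card_mul_sum_sq (s := Λ.powersetCard j) (f := Rs)
      rw [Finset.card_powersetCard, ← hn] at hcs
      rw [← Finset.sum_div, div_le_div_iff₀ (mul_pos hCpos hmpos) hmpos]
      have : A ^ 2 ≤ Cj * ∑ P ∈ Λ.powersetCard j, (Rs P) ^ 2 := by rw [hCj, hA]; exact hcs
      nlinarith [this, hmpos.le,
        Finset.sum_nonneg (fun P (_ : P ∈ Λ.powersetCard j) => sq_nonneg (Rs P))]
    have key : A ^ 2 / (Cj * m) ≤ m * A - ((j : ℝ) + 1) * A' :=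
      hlhs.trans (hsum1.trans hrhs.le)
    have hAeq : A = Cj * v j := by
      rw [show v j = A / Cj from rfl]; field_simp
    have hA'eq : ((j : ℝ) + 1) * A' = m * Cj * v (j + 1) := by
      rw [show v (j + 1) = A' / Cj' from rfl, mul_div_assoc', hpascal.symm]; field_simp
    rw [hAeq, hA'eq] at key
    have key2 : m * Cj * v (j + 1) ≤ m * Cj * (v j - (v j) ^ 2 / m ^ 2) := by
      have : m * Cj * (v j - (v j) ^ 2 / m ^ 2) =
          m * (Cj * v j) - (Cj * v j) ^ 2 / (Cj * m) := by
        field_simp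
      rw [this]
      linarith
    exact le_of_mul_le_mul_left key2 (mul_pos hmpos hCpos)
  simpa only [hv] using riccati_bound h0 hstepv hkn

end Abstract

/-! ### The Ising instantiation -/

/-- **Bookkeeping stub `stub_linEffLeOne`** (registered signature, verbatim): the Gaussian
pinning-lemma ceiling for the LINEAR efficiency of the critical `+` box, `e^{lin}_L(k) ≤ 1` for
`k ≤ |Λ_L|` (Montanari 2008; Raghavendra–Tan 2012, Lemma 4.3, for Schur complements of the
Ising covariance: `pin_bound` with `t_x = σ_x − ⟨σ_x⟩⁺_L`, `w = w⁺_L/Z`, `G = cov L`). [folklore] -/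
theorem stub_linEffLeOne :
    ∀ (L k : ℕ), k ≤ (box 3 L).card → linEff L k ≤ 1 := by
  intro L k hk
  -- the plus state as a finite probability vector with positive entries
  have hZpos : 0 < isingPartitionFunction (zdGraph 3) (box 3 L) (criticalBeta 3) 0 .plus :=
    isingPartitionFunction_pos _ _ _ _ _
  have hwpos : ∀ τ, 0 < plusProb L τ := fun τ =>
    div_pos (isingWeight_pos (zdGraph 3) (box 3 L) (criticalBeta 3) 0 .plus τ) hZpos
  have hw1 : ∑ τ, plusProb L τ = 1 := by
    unfold plusProb; rw [← Finset.sum_div, div_eq_one_iff_eq hZpos.ne']; rfl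
  have hplusE : ∀ {f : SpinConfig (Site 3) → ℝ}, Measurable f →
      plusE L f = ∑ τ, plusProb L τ * f (glue (box 3 L) τ .plus) := by
    intro f hf
    have h : plusE L f = (∑ τ, isingWeight (zdGraph 3) (box 3 L) (criticalBeta 3) 0 .plus τ *
        f (glue (box 3 L) τ .plus)) /
          isingPartitionFunction (zdGraph 3) (box 3 L) (criticalBeta 3) 0 .plus :=
      integral_isingMeasure (zdGraph 3) (box 3 L) (criticalBeta 3) 0 .plus hf
    rw [h, Finset.sum_div]
    exact Finset.sum_congr rfl fun τ _ => by unfold plusProb; ring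
  -- centred spins `t_x = σ_x − ⟨σ_x⟩⁺`
  set s : Site 3 → (↥(box 3 L) → ℤˣ) → ℝ := fun x τ => spinAt x (glue (box 3 L) τ .plus) with hs
  set t : Site 3 → (↥(box 3 L) → ℤˣ) → ℝ := fun x τ => s x τ - plusE L (spinAt x) with ht
  have hμ : ∀ x, ∑ τ, plusProb L τ * s x τ = plusE L (spinAt x) := fun x =>
    (hplusE (measurable_spinAt x)).symm
  have hG : ∀ x y, cov L x y = ∑ τ, plusProb L τ * t x τ * t y τ := by
    intro x y
    have h1 : plusE L (fun σ => spinAt x σ * spinAt y σ) = ∑ τ, plusProb L τ * (s x τ * s y τ) :=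
      hplusE ((measurable_spinAt x).fun_mul (measurable_spinAt y))
    have h2 : ∀ τ, plusProb L τ * t x τ * t y τ = plusProb L τ * (s x τ * s y τ)
        - plusE L (spinAt y) * (plusProb L τ * s x τ) - plusE L (spinAt x) * (plusProb L τ * s y τ)
        + plusE L (spinAt x) * plusE L (spinAt y) * plusProb L τ := fun τ => by
      simp only [ht]; ring
    unfold cov
    rw [h1, Finset.sum_congr rfl fun τ _ => h2 τ, Finset.sum_add_distrib, Finset.sum_sub_distrib,
      Finset.sum_sub_distrib, ← Finset.mul_sum, ← Finset.mul_sum, ← Finset.mul_sum, hμ, hμ, hw1]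
    ring
  have hG1 : ∀ z, cov L z z ≤ 1 := fun z => by
    have h1 : plusE L (fun σ => spinAt z σ * spinAt z σ) = 1 := by
      rw [hplusE ((measurable_spinAt z).fun_mul (measurable_spinAt z))]
      simp only [spinAt_mul_self, mul_one, hw1]
    unfold cov; rw [h1]; nlinarith [sq_nonneg (plusE L (spinAt z))]
  -- flipping one spin of the all-plus pattern changes exactly one centred spin
  have hflip : ∀ x ∈ box 3 L, ∃ ω ω' : ↥(box 3 L) → ℤˣ,
      t x ω ≠ t x ω' ∧ ∀ y, y ≠ x → t y ω = t y ω' := by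
    intro x hx
    refine ⟨fun _ => 1, Function.update (fun _ => 1) ⟨x, hx⟩ (-1), ?_, fun y hy => ?_⟩
    · simp only [ht, hs, spinAt, glue_apply_of_mem _ _ _ hx, Function.update_self]
      norm_num
    · by_cases hyΛ : y ∈ box 3 L
      · have hne : (⟨y, hyΛ⟩ : ↥(box 3 L)) ≠ ⟨x, hx⟩ := fun h => hy (congrArg Subtype.val h)
        simp only [ht, hs, spinAt, glue_apply_of_mem _ _ _ hyΛ, Function.update_of_ne hne]
      · simp only [ht, hs, spinAt, glue_apply_of_notMem _ _ _ hyΛ]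
  -- the abstract pinning lemma for the linear residual, and the normalisation
  have hmain := pin_bound (w := plusProb L) (t := t) (G := cov L) (Λ := box 3 L)
    (c := covTot L) (Mc := fun τ => ∑ x ∈ box 3 L, t x τ) (Rs := linResidual L)
    hwpos hG hflip (fun _ => rfl) (fun _ => rfl) (fun _ => rfl) hG1 hk
  have hD : (0 : ℝ) < (((box 3 L).card : ℝ) + 1) * (((box 3 L).card : ℝ) - k + 1) := by
    have : (k : ℝ) ≤ (box 3 L).card := by exact_mod_cast hk
    exact mul_pos (by positivity) (by linarith)
  unfold linEff effOf linVar
  rw [div_le_one hD]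
  exact hmain

end Summit.CriticalPhenomena.Ising3DConformalLimit.PlantedPinningGaussianPinningSaturation

end
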